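import Summits.QuantumFields.YangMills.Theorems.IsotropyFromPowerCountingTemperedCurvatureMomentsThreePointKernelPart1
import Summits.QuantumFields.YangMills.Theorems.IsotropyFromPowerCountingTemperedCurvatureMomentsThreePointKernelPart2

/-!
# Three-point kernel of `TemperedCurvatureMoments`, part 3: slot bounds and the local kernel at a triple

Support file for stub `stub_threePointKernel` of reshape 4 of
`Cruxes/TemperedCurvatureMoments/Lines/Sketch.lean` (crux stmt-QuantumFields-17721, line `Sketch`).
`slot_bound_core`: a chart bound for pairs below a mirror of unit normal `n` and `g` beyond the gap `s/2`
gives, by E3 (slot `k` moved last) and the mirror geometry of part 2, the slot bound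
`‖𝔖₃(⊗ update f k (∂_tᴺ f_k))‖ ≤ A ∏ |fᵢ|` for factors in `B(yᵢ, s/8)` when slot `k` is isolated `c·r ≥ s`
above the others; `slotData_axis/diag/of_good`: a GOOD slot (stub D) carries a spanning direction family
in the frame menu with slot bounds of constant `C (2/s)ᵖ` (uniform chart bounds of stub B);
`exists_localKernel`: two good slots ⇒ stub C applies to `Λ = 𝔖₃ / (C (2/s)ᵖ)` on `∏ B(yᵢ, s/8)`, giving
a continuous local kernel on `∏ B(yᵢ, s/16)` bounded by `C (2/s)ᵖ · B₀ (8/s)^q (1 + ‖y‖)^q`. [folklore]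
-/

noncomputable section

namespace Summit.QuantumFields.YangMills.Theorems.TemperedCurvatureMoments.Sketch

open scoped BigOperators SchwartzMap
open MeasureTheory Filter Topology Set Metric
open Literature.MathematicalPhysics.QuantumFieldTheory Literature.MathematicalPhysics.QuantumLattice
open Literature.MathematicalPhysics.AQFT
open Summit.QuantumFields.YangMills.Theorems.NPointIsotropy.Negative (E4)

namespace ThreePointKernel

/-- **Slot bound from a chart bound.** Let `𝔖₃` be E3-symmetric on `⁰𝒮₃`, `n` a unit normal, slot `k`
of the triple `y` isolated `c·r` above the other two in direction `n`, `0 < s ≤ min(1, c·r)` below all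
pairwise distances, and suppose the chart bound `‖𝔖₃(f₁ ⊗ f₂ ⊗ ∂_tᴺ g)‖ ≤ A |f₁| |f₂| |g|` holds for
compactly supported pairs below any mirror `{⟪x,n⟫ = c₀}` subject to a pair condition `P` and `g`
beyond the gap `s/2`. Then for factors `fᵢ` supported in `B(yᵢ, s/8)` whose two non-`k` factors satisfy
`P`, every tensor of `update f k (∂_tᴺ f_k)` obeys `‖𝔖₃ F‖ ≤ A ∏ |fᵢ|` (move slot `k` last by the
transposition `(k 2)`; the tensor is off-diagonal since the balls are disjoint). [folklore] -/
theorem slot_bound_core (S₃ : 𝓢((Fin 3 → E4), ℂ) →L[ℂ] ℂ)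
    (hsymm : ∀ (π : Equiv.Perm (Fin 3)) (F : 𝓢((Fin 3 → E4), ℂ)), IsOffDiagonal F → S₃ (permTest π F) = S₃ F)
    {n t : E4} (hn : ‖n‖ = 1) {y : Fin 3 → E4} {k : Fin 3} {c r s : ℝ}
    (hgap : ∀ i, i ≠ k → inner ℝ (y i) n + c * r ≤ inner ℝ (y k) n) (hs : 0 < s) (hsr : s ≤ c * r)
    (hsd : ∀ i j, i ≠ j → s ≤ dist (y i) (y j)) {M₀ N : ℕ} {A : ℝ}
    (P : 𝓢(E4, ℂ) → 𝓢(E4, ℂ) → Prop)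
    (hchart : ∀ (c₀ : ℝ) (f₁ f₂ g : 𝓢(E4, ℂ)), HasCompactSupport (f₁ : E4 → ℂ) →
      HasCompactSupport (f₂ : E4 → ℂ) → HasCompactSupport (g : E4 → ℂ) →
      tsupport (f₁ : E4 → ℂ) ⊆ {x : E4 | inner ℝ x n < c₀} → tsupport (f₂ : E4 → ℂ) ⊆ {x : E4 | inner ℝ x n < c₀} →
      tsupport (g : E4 → ℂ) ⊆ {x : E4 | c₀ + s / 2 < inner ℝ x n} → P f₁ f₂ →
      ∀ F : 𝓢((Fin 3 → E4), ℂ), IsTensorOf F ![f₁, f₂, ((LineDeriv.lineDerivOp t : 𝓢(E4, ℂ) → 𝓢(E4, ℂ))^[N] g)] →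
        ‖S₃ F‖ ≤ A * schwartzNorm M₀ f₁ * schwartzNorm M₀ f₂ * schwartzNorm M₀ g)
    (f : Fin 3 → 𝓢(E4, ℂ)) (hf : ∀ i, tsupport (f i : E4 → ℂ) ⊆ ball (y i) (s / 8))
    (hP : P (f (Equiv.swap k 2 0)) (f (Equiv.swap k 2 1)))
    (F : 𝓢((Fin 3 → E4), ℂ))
    (hF : IsTensorOf F (Function.update f k ((LineDeriv.lineDerivOp t : 𝓢(E4, ℂ) → 𝓢(E4, ℂ))^[N] (f k)))) :
    ‖S₃ F‖ ≤ A * ∏ i, schwartzNorm M₀ (f i) := by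
  obtain ⟨h0, h1, -⟩ := swap_fin_three_ne k
  have hsep2 : ∀ a b, a ≠ b → 2 * (s / 8) < dist (y a) (y b) := fun a b hab => by
    have := hsd a b hab
    linarith
  have hoff : IsOffDiagonal F :=
    isOffDiagonal_of_isTensorOf_ball hsep2 (fun j => (tsupport_update_iterate_subset f k t N j).trans (hf j)) hF
  have hperm : S₃ (permTest (Equiv.swap k 2) F) = S₃ F := hsymm _ F hoff
  have hF' := isTensorOf_permTest_swap hF
  obtain ⟨hlow, hhigh⟩ := supports_of_gap hn hgap hs hsr hf
  have hb := hchart (inner ℝ (y k) n - c * r + s / 8) (f (Equiv.swap k 2 0)) (f (Equiv.swap k 2 1)) (f k)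
    (hasCompactSupport_of_tsupport_subset_ball (hf _)) (hasCompactSupport_of_tsupport_subset_ball (hf _))
    (hasCompactSupport_of_tsupport_subset_ball (hf k)) (hlow _ h0) (hlow _ h1) hhigh hP _ hF'
  rw [hperm] at hb
  rw [prod_eq_swap_mul (fun j => schwartzNorm M₀ (f j)) k]
  exact hb.trans (le_of_eq (by ring))

/-- **Axis-good slot.** If slot `k` of `y` lies `c·r` above an `e_μ`-separated pair in the axis frame
`s₀ e_μ`, then `D_k = {s₀ e_μ} ∪ {e_ν : ν ≠ μ}` lies in the frame menu (`s₀ e_μ` is the time direction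
and `e_ν` the partner of the axis frame `(s₀ e_μ, e_ν)`), spans `ℝ⁴`, and the uniform chart bounds for
`n`-ORDERED pairs give the slot bounds at slot `k` along every `t ∈ D_k` with constant `C (2/s)ᵖ` for
factors supported in `B(yᵢ, s/8)`, `0 < s ≤ min(1, c·r, min dist)`. [folklore] -/
theorem slotData_axis (S₃ : 𝓢((Fin 3 → E4), ℂ) →L[ℂ] ℂ)
    (hsymm : ∀ (π : Equiv.Perm (Fin 3)) (F : 𝓢((Fin 3 → E4), ℂ)), IsOffDiagonal F → S₃ (permTest π F) = S₃ F)
    {M₀ N₁ : ℕ} {Cst : ℝ} {pst : ℕ}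
    (hAX : ∀ N : ℕ, N ≤ N₁ → ∀ (μ ν : Fin 4) (s s' : ℝ), μ ≠ ν → (s = 1 ∨ s = -1) → (s' = 1 ∨ s' = -1) →
      ∀ δ : ℝ, 0 < δ → δ ≤ 1 → ∀ (c : ℝ) (f₁ f₂ g : 𝓢(E4, ℂ)),
        HasCompactSupport (f₁ : E4 → ℂ) → HasCompactSupport (f₂ : E4 → ℂ) → HasCompactSupport (g : E4 → ℂ) →
        tsupport (f₁ : E4 → ℂ) ⊆ {x : E4 | inner ℝ x (s • (EuclideanSpace.single μ (1 : ℝ) : E4)) < c} →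
        tsupport (f₂ : E4 → ℂ) ⊆ {x : E4 | inner ℝ x (s • (EuclideanSpace.single μ (1 : ℝ) : E4)) < c} →
        tsupport (g : E4 → ℂ) ⊆ {x : E4 | c + δ < inner ℝ x (s • (EuclideanSpace.single μ (1 : ℝ) : E4))} →
        (∃ c' : ℝ, (tsupport (f₁ : E4 → ℂ) ⊆ {x : E4 | inner ℝ x (s • (EuclideanSpace.single μ (1 : ℝ) : E4)) < c'} ∧
            tsupport (f₂ : E4 → ℂ) ⊆ {x : E4 | c' < inner ℝ x (s • (EuclideanSpace.single μ (1 : ℝ) : E4))}) ∨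
          (tsupport (f₂ : E4 → ℂ) ⊆ {x : E4 | inner ℝ x (s • (EuclideanSpace.single μ (1 : ℝ) : E4)) < c'} ∧
            tsupport (f₁ : E4 → ℂ) ⊆ {x : E4 | c' < inner ℝ x (s • (EuclideanSpace.single μ (1 : ℝ) : E4))})) →
        ∀ w : E4, (w = s • (EuclideanSpace.single μ (1 : ℝ) : E4) ∨ w = s' • (EuclideanSpace.single ν (1 : ℝ) : E4)) →
        ∀ F : 𝓢((Fin 3 → E4), ℂ),
          IsTensorOf F ![f₁, f₂, ((LineDeriv.lineDerivOp w : 𝓢(E4, ℂ) → 𝓢(E4, ℂ))^[N] g)] →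
            ‖S₃ F‖ ≤ Cst * (1 / δ) ^ pst * schwartzNorm M₀ f₁ * schwartzNorm M₀ f₂ * schwartzNorm M₀ g)
    {c r s : ℝ} {y : Fin 3 → E4} {k : Fin 3} (hs : 0 < s) (hs1 : s ≤ 1) (hsr : s ≤ c * r)
    (hsd : ∀ i j, i ≠ j → s ≤ dist (y i) (y j)) {μ : Fin 4} {s₀ : ℝ} (hs₀ : s₀ = 1 ∨ s₀ = -1)
    (hgap : ∀ i, i ≠ k → inner ℝ (y i) (s₀ • (EuclideanSpace.single μ (1 : ℝ) : E4)) + c * r ≤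
      inner ℝ (y k) (s₀ • (EuclideanSpace.single μ (1 : ℝ) : E4)))
    (hsep : ∀ i i', i ≠ k → i' ≠ k → i ≠ i' →
      c * r ≤ |inner ℝ (y i) (EuclideanSpace.single μ (1 : ℝ) : E4) - inner ℝ (y i') (EuclideanSpace.single μ (1 : ℝ) : E4)|) :
    ∃ Dk : Finset E4,
      (∀ t ∈ Dk, ∃ n v : E4, ((∃ (μ ν : Fin 4) (s s' : ℝ), μ ≠ ν ∧ (s = 1 ∨ s = -1) ∧ (s' = 1 ∨ s' = -1) ∧
            n = s • (EuclideanSpace.single μ (1 : ℝ) : E4) ∧ v = s' • (EuclideanSpace.single ν (1 : ℝ) : E4)) ∨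
          (∃ (μ ν : Fin 4) (s s' : ℝ), μ ≠ ν ∧ (s = 1 ∨ s = -1) ∧ (s' = 1 ∨ s' = -1) ∧
            n = (Real.sqrt 2)⁻¹ • (s • (EuclideanSpace.single μ (1 : ℝ) : E4) + s' • (EuclideanSpace.single ν (1 : ℝ) : E4)) ∧
            v = (Real.sqrt 2)⁻¹ • (s • (EuclideanSpace.single μ (1 : ℝ) : E4) - s' • (EuclideanSpace.single ν (1 : ℝ) : E4)))) ∧
          (t = n ∨ t = v)) ∧
      ⊤ ≤ Submodule.span ℝ (Dk : Set E4) ∧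
      ∀ t ∈ Dk, ∀ N : ℕ, N ≤ N₁ → ∀ f : Fin 3 → 𝓢(E4, ℂ),
        (∀ i, tsupport (f i : E4 → ℂ) ⊆ Metric.ball (y i) (s / 8)) → ∀ F : 𝓢((Fin 3 → E4), ℂ),
          IsTensorOf F (Function.update f k ((LineDeriv.lineDerivOp t : 𝓢(E4, ℂ) → 𝓢(E4, ℂ))^[N] (f k))) →
            ‖S₃ F‖ ≤ Cst * (1 / (s / 2)) ^ pst * ∏ i, schwartzNorm M₀ (f i) := by
  set n₀ : E4 := s₀ • (EuclideanSpace.single μ (1 : ℝ) : E4) with hn₀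
  have hn : ‖n₀‖ = 1 := norm_axis_eq_one μ hs₀
  set Dk : Finset E4 := Finset.image (fun ν : Fin 4 => if ν = μ then s₀ • (EuclideanSpace.single μ (1 : ℝ) : E4)
      else (EuclideanSpace.single ν (1 : ℝ) : E4)) Finset.univ with hDk
  -- every `t ∈ D_k` is `n₀` or another axis `e_ν'`, `ν' ≠ μ`
  have hDmem : ∀ t ∈ Dk, ∃ ν' : Fin 4, μ ≠ ν' ∧ (t = n₀ ∨ t = (1 : ℝ) • (EuclideanSpace.single ν' (1 : ℝ) : E4)) := by
    intro t ht
    rw [hDk, Finset.mem_image] at ht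
    obtain ⟨ν, -, rfl⟩ := ht
    by_cases hν : ν = μ
    · obtain ⟨ν', hν'⟩ := exists_ne μ
      exact ⟨ν', hν'.symm, Or.inl (by rw [if_pos hν])⟩
    · exact ⟨ν, Ne.symm hν, Or.inr (by rw [if_neg hν, one_smul])⟩
  refine ⟨Dk, fun t ht => ?_, top_le_span_axisDirs μ hs₀, fun t ht N hN f hf F hF => ?_⟩
  · obtain ⟨ν', hμν', ht⟩ := hDmem t ht
    exact ⟨n₀, (1 : ℝ) • (EuclideanSpace.single ν' (1 : ℝ) : E4),
      Or.inl ⟨μ, ν', s₀, 1, hμν', hs₀, Or.inl rfl, rfl, rfl⟩, ht⟩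
  · obtain ⟨ν', hμν', hw⟩ := hDmem t ht
    obtain ⟨h0, h1, h01⟩ := swap_fin_three_ne k
    have hsep' : c * r ≤ |inner ℝ (y (Equiv.swap k 2 0)) n₀ - inner ℝ (y (Equiv.swap k 2 1)) n₀| := by
      rw [hn₀, abs_inner_sign_smul_sub hs₀]
      exact hsep _ _ h0 h1 h01
    refine slot_bound_core S₃ hsymm hn hgap hs hsr hsd
      (fun f₁ f₂ => ∃ c' : ℝ, (tsupport (f₁ : E4 → ℂ) ⊆ {x : E4 | inner ℝ x n₀ < c'} ∧
          tsupport (f₂ : E4 → ℂ) ⊆ {x : E4 | c' < inner ℝ x n₀}) ∨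
        (tsupport (f₂ : E4 → ℂ) ⊆ {x : E4 | inner ℝ x n₀ < c'} ∧ tsupport (f₁ : E4 → ℂ) ⊆ {x : E4 | c' < inner ℝ x n₀}))
      (fun c₀ f₁ f₂ g hc₁ hc₂ hcg hf₁ hf₂ hg hP G hG => hAX N hN μ ν' s₀ 1 hμν' hs₀ (Or.inl rfl) (s / 2) (by positivity)
        (by linarith) c₀ f₁ f₂ g hc₁ hc₂ hcg hf₁ hf₂ hg hP t hw G hG)
      f hf (ordered_of_separated hn hsep' hs hsr hf) F hF

/-- **Diagonal-good slot.** If slot `k` of `y` lies `c·r` above the other two in four diagonal frames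
whose time / partner directions `t_j` are linearly independent, then `D_k = {t_j}` lies in the frame
menu, spans `ℝ⁴`, and the uniform chart bounds for DISJOINT pairs in diagonal frames give the slot
bounds at slot `k` along every `t ∈ D_k` (the two other factors have disjoint supports since their
balls are disjoint). [folklore] -/
theorem slotData_diag (S₃ : 𝓢((Fin 3 → E4), ℂ) →L[ℂ] ℂ)
    (hsymm : ∀ (π : Equiv.Perm (Fin 3)) (F : 𝓢((Fin 3 → E4), ℂ)), IsOffDiagonal F → S₃ (permTest π F) = S₃ F)
    {M₀ N₁ : ℕ} {Cst : ℝ} {pst : ℕ}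
    (hDG : ∀ N : ℕ, N ≤ N₁ → ∀ (n v : E4),
      (∃ (μ ν : Fin 4) (s s' : ℝ), μ ≠ ν ∧ (s = 1 ∨ s = -1) ∧ (s' = 1 ∨ s' = -1) ∧
        n = (Real.sqrt 2)⁻¹ • (s • (EuclideanSpace.single μ (1 : ℝ) : E4) + s' • (EuclideanSpace.single ν (1 : ℝ) : E4)) ∧
        v = (Real.sqrt 2)⁻¹ • (s • (EuclideanSpace.single μ (1 : ℝ) : E4) - s' • (EuclideanSpace.single ν (1 : ℝ) : E4))) →
      ∀ δ : ℝ, 0 < δ → δ ≤ 1 → ∀ (c : ℝ) (f₁ f₂ g : 𝓢(E4, ℂ)),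
        HasCompactSupport (f₁ : E4 → ℂ) → HasCompactSupport (f₂ : E4 → ℂ) → HasCompactSupport (g : E4 → ℂ) →
        tsupport (f₁ : E4 → ℂ) ⊆ {x : E4 | inner ℝ x n < c} → tsupport (f₂ : E4 → ℂ) ⊆ {x : E4 | inner ℝ x n < c} →
        tsupport (g : E4 → ℂ) ⊆ {x : E4 | c + δ < inner ℝ x n} →
        Disjoint (tsupport (f₁ : E4 → ℂ)) (tsupport (f₂ : E4 → ℂ)) →
        ∀ w : E4, (w = n ∨ w = v) → ∀ F : 𝓢((Fin 3 → E4), ℂ),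
          IsTensorOf F ![f₁, f₂, ((LineDeriv.lineDerivOp w : 𝓢(E4, ℂ) → 𝓢(E4, ℂ))^[N] g)] →
            ‖S₃ F‖ ≤ Cst * (1 / δ) ^ pst * schwartzNorm M₀ f₁ * schwartzNorm M₀ f₂ * schwartzNorm M₀ g)
    {c r s : ℝ} {y : Fin 3 → E4} {k : Fin 3} (hs : 0 < s) (hs1 : s ≤ 1) (hsr : s ≤ c * r)
    (hsd : ∀ i j, i ≠ j → s ≤ dist (y i) (y j)) {t₄ : Fin 4 → E4} (hli : LinearIndependent ℝ t₄)
    (hj : ∀ j, ∃ n v : E4, (∃ (μ ν : Fin 4) (s s' : ℝ), μ ≠ ν ∧ (s = 1 ∨ s = -1) ∧ (s' = 1 ∨ s' = -1) ∧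
        n = (Real.sqrt 2)⁻¹ • (s • (EuclideanSpace.single μ (1 : ℝ) : E4) + s' • (EuclideanSpace.single ν (1 : ℝ) : E4)) ∧
        v = (Real.sqrt 2)⁻¹ • (s • (EuclideanSpace.single μ (1 : ℝ) : E4) - s' • (EuclideanSpace.single ν (1 : ℝ) : E4))) ∧
      (t₄ j = n ∨ t₄ j = v) ∧ ∀ i, i ≠ k → inner ℝ (y i) n + c * r ≤ inner ℝ (y k) n) :
    ∃ Dk : Finset E4,
      (∀ t ∈ Dk, ∃ n v : E4, ((∃ (μ ν : Fin 4) (s s' : ℝ), μ ≠ ν ∧ (s = 1 ∨ s = -1) ∧ (s' = 1 ∨ s' = -1) ∧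
            n = s • (EuclideanSpace.single μ (1 : ℝ) : E4) ∧ v = s' • (EuclideanSpace.single ν (1 : ℝ) : E4)) ∨
          (∃ (μ ν : Fin 4) (s s' : ℝ), μ ≠ ν ∧ (s = 1 ∨ s = -1) ∧ (s' = 1 ∨ s' = -1) ∧
            n = (Real.sqrt 2)⁻¹ • (s • (EuclideanSpace.single μ (1 : ℝ) : E4) + s' • (EuclideanSpace.single ν (1 : ℝ) : E4)) ∧
            v = (Real.sqrt 2)⁻¹ • (s • (EuclideanSpace.single μ (1 : ℝ) : E4) - s' • (EuclideanSpace.single ν (1 : ℝ) : E4)))) ∧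
          (t = n ∨ t = v)) ∧
      ⊤ ≤ Submodule.span ℝ (Dk : Set E4) ∧
      ∀ t ∈ Dk, ∀ N : ℕ, N ≤ N₁ → ∀ f : Fin 3 → 𝓢(E4, ℂ),
        (∀ i, tsupport (f i : E4 → ℂ) ⊆ Metric.ball (y i) (s / 8)) → ∀ F : 𝓢((Fin 3 → E4), ℂ),
          IsTensorOf F (Function.update f k ((LineDeriv.lineDerivOp t : 𝓢(E4, ℂ) → 𝓢(E4, ℂ))^[N] (f k))) →
            ‖S₃ F‖ ≤ Cst * (1 / (s / 2)) ^ pst * ∏ i, schwartzNorm M₀ (f i) := by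
  set Dk : Finset E4 := Finset.image t₄ Finset.univ with hDk
  have hDmem : ∀ t ∈ Dk, ∃ j : Fin 4, t = t₄ j := fun t ht => by
    obtain ⟨j, -, rfl⟩ := Finset.mem_image.1 (by rwa [hDk] at ht)
    exact ⟨j, rfl⟩
  refine ⟨Dk, fun t ht => ?_, top_le_span_image_of_linearIndependent hli, fun t ht N hN f hf F hF => ?_⟩
  · obtain ⟨j, rfl⟩ := hDmem t ht
    obtain ⟨n, v, hdg, htj, -⟩ := hj j
    exact ⟨n, v, Or.inr hdg, htj⟩
  · obtain ⟨j, rfl⟩ := hDmem _ ht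
    obtain ⟨n, v, hdg, hw, hgap⟩ := hj j
    have hn : ‖n‖ = 1 := by
      obtain ⟨μ, ν, σ, σ', hμν, hσ, hσ', rfl, -⟩ := hdg
      exact (norm_diag_eq_one hμν hσ hσ').1
    obtain ⟨-, -, h01⟩ := swap_fin_three_ne k
    refine slot_bound_core S₃ hsymm hn hgap hs hsr hsd
      (fun f₁ f₂ => Disjoint (tsupport (f₁ : E4 → ℂ)) (tsupport (f₂ : E4 → ℂ)))
      (fun c₀ f₁ f₂ g hc₁ hc₂ hcg hf₁ hf₂ hg hP G hG => hDG N hN n v hdg (s / 2) (by positivity)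
        (by linarith) c₀ f₁ f₂ g hc₁ hc₂ hcg hf₁ hf₂ hg hP (t₄ j) hw G hG)
      f hf (disjoint_tsupport_of_ball (hsd _ _ h01) hs hf) F hF

/-- **A good slot** (either clause of stub D) carries a spanning direction family in the frame menu with
the slot bounds of constant `C (2/s)ᵖ`: `slotData_axis` or `slotData_diag`. [folklore] -/
theorem slotData_of_good (S₃ : 𝓢((Fin 3 → E4), ℂ) →L[ℂ] ℂ)
    (hsymm : ∀ (π : Equiv.Perm (Fin 3)) (F : 𝓢((Fin 3 → E4), ℂ)), IsOffDiagonal F → S₃ (permTest π F) = S₃ F)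
    {M₀ N₁ : ℕ} {Cst : ℝ} {pst : ℕ}
    (hAX : ∀ N : ℕ, N ≤ N₁ → ∀ (μ ν : Fin 4) (s s' : ℝ), μ ≠ ν → (s = 1 ∨ s = -1) → (s' = 1 ∨ s' = -1) →
      ∀ δ : ℝ, 0 < δ → δ ≤ 1 → ∀ (c : ℝ) (f₁ f₂ g : 𝓢(E4, ℂ)),
        HasCompactSupport (f₁ : E4 → ℂ) → HasCompactSupport (f₂ : E4 → ℂ) → HasCompactSupport (g : E4 → ℂ) →
        tsupport (f₁ : E4 → ℂ) ⊆ {x : E4 | inner ℝ x (s • (EuclideanSpace.single μ (1 : ℝ) : E4)) < c} →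
        tsupport (f₂ : E4 → ℂ) ⊆ {x : E4 | inner ℝ x (s • (EuclideanSpace.single μ (1 : ℝ) : E4)) < c} →
        tsupport (g : E4 → ℂ) ⊆ {x : E4 | c + δ < inner ℝ x (s • (EuclideanSpace.single μ (1 : ℝ) : E4))} →
        (∃ c' : ℝ, (tsupport (f₁ : E4 → ℂ) ⊆ {x : E4 | inner ℝ x (s • (EuclideanSpace.single μ (1 : ℝ) : E4)) < c'} ∧
            tsupport (f₂ : E4 → ℂ) ⊆ {x : E4 | c' < inner ℝ x (s • (EuclideanSpace.single μ (1 : ℝ) : E4))}) ∨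
          (tsupport (f₂ : E4 → ℂ) ⊆ {x : E4 | inner ℝ x (s • (EuclideanSpace.single μ (1 : ℝ) : E4)) < c'} ∧
            tsupport (f₁ : E4 → ℂ) ⊆ {x : E4 | c' < inner ℝ x (s • (EuclideanSpace.single μ (1 : ℝ) : E4))})) →
        ∀ w : E4, (w = s • (EuclideanSpace.single μ (1 : ℝ) : E4) ∨ w = s' • (EuclideanSpace.single ν (1 : ℝ) : E4)) →
        ∀ F : 𝓢((Fin 3 → E4), ℂ),
          IsTensorOf F ![f₁, f₂, ((LineDeriv.lineDerivOp w : 𝓢(E4, ℂ) → 𝓢(E4, ℂ))^[N] g)] →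
            ‖S₃ F‖ ≤ Cst * (1 / δ) ^ pst * schwartzNorm M₀ f₁ * schwartzNorm M₀ f₂ * schwartzNorm M₀ g)
    (hDG : ∀ N : ℕ, N ≤ N₁ → ∀ (n v : E4),
      (∃ (μ ν : Fin 4) (s s' : ℝ), μ ≠ ν ∧ (s = 1 ∨ s = -1) ∧ (s' = 1 ∨ s' = -1) ∧
        n = (Real.sqrt 2)⁻¹ • (s • (EuclideanSpace.single μ (1 : ℝ) : E4) + s' • (EuclideanSpace.single ν (1 : ℝ) : E4)) ∧
        v = (Real.sqrt 2)⁻¹ • (s • (EuclideanSpace.single μ (1 : ℝ) : E4) - s' • (EuclideanSpace.single ν (1 : ℝ) : E4))) →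
      ∀ δ : ℝ, 0 < δ → δ ≤ 1 → ∀ (c : ℝ) (f₁ f₂ g : 𝓢(E4, ℂ)),
        HasCompactSupport (f₁ : E4 → ℂ) → HasCompactSupport (f₂ : E4 → ℂ) → HasCompactSupport (g : E4 → ℂ) →
        tsupport (f₁ : E4 → ℂ) ⊆ {x : E4 | inner ℝ x n < c} → tsupport (f₂ : E4 → ℂ) ⊆ {x : E4 | inner ℝ x n < c} →
        tsupport (g : E4 → ℂ) ⊆ {x : E4 | c + δ < inner ℝ x n} →
        Disjoint (tsupport (f₁ : E4 → ℂ)) (tsupport (f₂ : E4 → ℂ)) →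
        ∀ w : E4, (w = n ∨ w = v) → ∀ F : 𝓢((Fin 3 → E4), ℂ),
          IsTensorOf F ![f₁, f₂, ((LineDeriv.lineDerivOp w : 𝓢(E4, ℂ) → 𝓢(E4, ℂ))^[N] g)] →
            ‖S₃ F‖ ≤ Cst * (1 / δ) ^ pst * schwartzNorm M₀ f₁ * schwartzNorm M₀ f₂ * schwartzNorm M₀ g)
    {c r s : ℝ} {y : Fin 3 → E4} {k : Fin 3} (hs : 0 < s) (hs1 : s ≤ 1) (hsr : s ≤ c * r)
    (hsd : ∀ i j, i ≠ j → s ≤ dist (y i) (y j))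
    (hgood : (∃ (μ : Fin 4) (s : ℝ), (s = 1 ∨ s = -1) ∧
        (∀ i, i ≠ k → inner ℝ (y i) (s • (EuclideanSpace.single μ (1 : ℝ) : E4)) + c * r ≤
          inner ℝ (y k) (s • (EuclideanSpace.single μ (1 : ℝ) : E4))) ∧
        (∀ i i', i ≠ k → i' ≠ k → i ≠ i' →
          c * r ≤ |inner ℝ (y i) (EuclideanSpace.single μ (1 : ℝ) : E4) - inner ℝ (y i') (EuclideanSpace.single μ (1 : ℝ) : E4)|)) ∨
      (∃ t : Fin 4 → E4, LinearIndependent ℝ t ∧ ∀ j, ∃ n v : E4, (∃ (μ ν : Fin 4) (s s' : ℝ), μ ≠ ν ∧ (s = 1 ∨ s = -1) ∧ (s' = 1 ∨ s' = -1) ∧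
      n = (Real.sqrt 2)⁻¹ • (s • (EuclideanSpace.single μ (1 : ℝ) : E4) + s' • (EuclideanSpace.single ν (1 : ℝ) : E4)) ∧
      v = (Real.sqrt 2)⁻¹ • (s • (EuclideanSpace.single μ (1 : ℝ) : E4) - s' • (EuclideanSpace.single ν (1 : ℝ) : E4))) ∧ (t j = n ∨ t j = v) ∧
        ∀ i, i ≠ k → inner ℝ (y i) n + c * r ≤ inner ℝ (y k) n)) :
    ∃ Dk : Finset E4,
      (∀ t ∈ Dk, ∃ n v : E4, ((∃ (μ ν : Fin 4) (s s' : ℝ), μ ≠ ν ∧ (s = 1 ∨ s = -1) ∧ (s' = 1 ∨ s' = -1) ∧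
            n = s • (EuclideanSpace.single μ (1 : ℝ) : E4) ∧ v = s' • (EuclideanSpace.single ν (1 : ℝ) : E4)) ∨
          (∃ (μ ν : Fin 4) (s s' : ℝ), μ ≠ ν ∧ (s = 1 ∨ s = -1) ∧ (s' = 1 ∨ s' = -1) ∧
            n = (Real.sqrt 2)⁻¹ • (s • (EuclideanSpace.single μ (1 : ℝ) : E4) + s' • (EuclideanSpace.single ν (1 : ℝ) : E4)) ∧
            v = (Real.sqrt 2)⁻¹ • (s • (EuclideanSpace.single μ (1 : ℝ) : E4) - s' • (EuclideanSpace.single ν (1 : ℝ) : E4)))) ∧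
          (t = n ∨ t = v)) ∧
      ⊤ ≤ Submodule.span ℝ (Dk : Set E4) ∧
      ∀ t ∈ Dk, ∀ N : ℕ, N ≤ N₁ → ∀ f : Fin 3 → 𝓢(E4, ℂ),
        (∀ i, tsupport (f i : E4 → ℂ) ⊆ Metric.ball (y i) (s / 8)) → ∀ F : 𝓢((Fin 3 → E4), ℂ),
          IsTensorOf F (Function.update f k ((LineDeriv.lineDerivOp t : 𝓢(E4, ℂ) → 𝓢(E4, ℂ))^[N] (f k))) →
            ‖S₃ F‖ ≤ Cst * (1 / (s / 2)) ^ pst * ∏ i, schwartzNorm M₀ (f i) := by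
  rcases hgood with ⟨μ, s₀, hs₀, hgap, hsep⟩ | ⟨t₄, hli, hj⟩
  · exact slotData_axis S₃ hsymm hAX hs hs1 hsr hsd hs₀ hgap hsep
  · exact slotData_diag S₃ hsymm hDG hs hs1 hsr hsd hli hj

/-- **The local kernel at a triple with two good slots.** Let `𝔖₃` be E3-symmetric and translation
invariant on `⁰𝒮₃`, obey the uniform chart bounds of stub B (order `M₀`, constant `C > 0`, power `p`,
all derivative orders `N ≤ N₁`), and let the three-slot regularity statement of stub C hold at order
`M₀` with data `N₁, q, B₀`. If two distinct slots `k₁ ≠ k₂` of `y` are good at scale `c·r` and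
`0 < s ≤ min(1, c·r)` lies below all pairwise distances, then on the box `∏ B(yᵢ, s/16)` the functional
`𝔖₃` is integration against a continuous kernel bounded by `C (2/s)ᵖ · B₀ (8/s)^q (1 + ‖y‖)^q`: stub C
applied to `Λ = 𝔖₃ / (C (2/s)ᵖ)` with the direction families of the two good slots (and `∅` at the
third), whose slot vectors with the diagonal translations span `(ℝ⁴)³`. [folklore] -/
theorem exists_localKernel (S₃ : 𝓢((Fin 3 → E4), ℂ) →L[ℂ] ℂ)
    (hsymm : ∀ (π : Equiv.Perm (Fin 3)) (F : 𝓢((Fin 3 → E4), ℂ)), IsOffDiagonal F → S₃ (permTest π F) = S₃ F)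
    (htr : ∀ (a : E4) (F : 𝓢((Fin 3 → E4), ℂ)), IsOffDiagonal F → S₃ (translateMulti a F) = S₃ F)
    {M₀ N₁ q : ℕ} {B₀ Cst : ℝ} {pst : ℕ} (hCst : 0 < Cst)
    (hreg : ∀ (D : Fin 3 → Finset E4),
      (∀ k, ∀ t ∈ D k, (∃ n v : E4, ((∃ (μ ν : Fin 4) (s s' : ℝ), μ ≠ ν ∧ (s = 1 ∨ s = -1) ∧ (s' = 1 ∨ s' = -1) ∧
            n = s • (EuclideanSpace.single μ (1 : ℝ) : E4) ∧ v = s' • (EuclideanSpace.single ν (1 : ℝ) : E4)) ∨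
          (∃ (μ ν : Fin 4) (s s' : ℝ), μ ≠ ν ∧ (s = 1 ∨ s = -1) ∧ (s' = 1 ∨ s' = -1) ∧
            n = (Real.sqrt 2)⁻¹ • (s • (EuclideanSpace.single μ (1 : ℝ) : E4) + s' • (EuclideanSpace.single ν (1 : ℝ) : E4)) ∧
            v = (Real.sqrt 2)⁻¹ • (s • (EuclideanSpace.single μ (1 : ℝ) : E4) - s' • (EuclideanSpace.single ν (1 : ℝ) : E4)))) ∧ (t = n ∨ t = v))) →
      (⊤ ≤ Submodule.span ℝ ((⋃ k : Fin 3, (fun t : E4 => (Pi.single k t : Fin 3 → E4)) '' (D k : Set E4)) ∪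
          Set.range (fun μ : Fin 4 => fun _ : Fin 3 => (EuclideanSpace.single μ (1 : ℝ) : E4)))) →
      ∀ (x : Fin 3 → E4) (ρ : ℝ), 0 < ρ → ρ ≤ 1 → (∀ i j, i ≠ j → 2 * ρ < dist (x i) (x j)) →
      ∀ Λ : 𝓢((Fin 3 → E4), ℂ) →L[ℂ] ℂ,
        (∀ (a : E4) (F : 𝓢((Fin 3 → E4), ℂ)), IsOffDiagonal F → Λ (translateMulti a F) = Λ F) →
        (∀ (k : Fin 3), ∀ t ∈ D k, ∀ N : ℕ, N ≤ N₁ → ∀ f : Fin 3 → 𝓢(E4, ℂ),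
          (∀ i, tsupport (f i : E4 → ℂ) ⊆ Metric.ball (x i) ρ) → ∀ F : 𝓢((Fin 3 → E4), ℂ),
            IsTensorOf F (Function.update f k ((LineDeriv.lineDerivOp t : 𝓢(E4, ℂ) → 𝓢(E4, ℂ))^[N] (f k))) →
              ‖Λ F‖ ≤ ∏ i, schwartzNorm M₀ (f i)) →
        ∃ K₃ : (Fin 3 → E4) → ℂ, ContinuousOn K₃ {y | ∀ i, y i ∈ Metric.ball (x i) (ρ / 2)} ∧
          (∀ y : Fin 3 → E4, (∀ i, y i ∈ Metric.ball (x i) (ρ / 2)) → ‖K₃ y‖ ≤ B₀ * ρ⁻¹ ^ q * (1 + ‖x‖) ^ q) ∧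
          ∀ F : 𝓢((Fin 3 → E4), ℂ), tsupport (F : (Fin 3 → E4) → ℂ) ⊆ {y | ∀ i, y i ∈ Metric.ball (x i) (ρ / 2)} →
            Integrable (fun y => K₃ y * F y) ∧ Λ F = ∫ y, K₃ y * F y)
    (hAX : ∀ N : ℕ, N ≤ N₁ → ∀ (μ ν : Fin 4) (s s' : ℝ), μ ≠ ν → (s = 1 ∨ s = -1) → (s' = 1 ∨ s' = -1) →
      ∀ δ : ℝ, 0 < δ → δ ≤ 1 → ∀ (c : ℝ) (f₁ f₂ g : 𝓢(E4, ℂ)),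
        HasCompactSupport (f₁ : E4 → ℂ) → HasCompactSupport (f₂ : E4 → ℂ) → HasCompactSupport (g : E4 → ℂ) →
        tsupport (f₁ : E4 → ℂ) ⊆ {x : E4 | inner ℝ x (s • (EuclideanSpace.single μ (1 : ℝ) : E4)) < c} →
        tsupport (f₂ : E4 → ℂ) ⊆ {x : E4 | inner ℝ x (s • (EuclideanSpace.single μ (1 : ℝ) : E4)) < c} →
        tsupport (g : E4 → ℂ) ⊆ {x : E4 | c + δ < inner ℝ x (s • (EuclideanSpace.single μ (1 : ℝ) : E4))} →
        (∃ c' : ℝ, (tsupport (f₁ : E4 → ℂ) ⊆ {x : E4 | inner ℝ x (s • (EuclideanSpace.single μ (1 : ℝ) : E4)) < c'} ∧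
            tsupport (f₂ : E4 → ℂ) ⊆ {x : E4 | c' < inner ℝ x (s • (EuclideanSpace.single μ (1 : ℝ) : E4))}) ∨
          (tsupport (f₂ : E4 → ℂ) ⊆ {x : E4 | inner ℝ x (s • (EuclideanSpace.single μ (1 : ℝ) : E4)) < c'} ∧
            tsupport (f₁ : E4 → ℂ) ⊆ {x : E4 | c' < inner ℝ x (s • (EuclideanSpace.single μ (1 : ℝ) : E4))})) →
        ∀ w : E4, (w = s • (EuclideanSpace.single μ (1 : ℝ) : E4) ∨ w = s' • (EuclideanSpace.single ν (1 : ℝ) : E4)) →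
        ∀ F : 𝓢((Fin 3 → E4), ℂ),
          IsTensorOf F ![f₁, f₂, ((LineDeriv.lineDerivOp w : 𝓢(E4, ℂ) → 𝓢(E4, ℂ))^[N] g)] →
            ‖S₃ F‖ ≤ Cst * (1 / δ) ^ pst * schwartzNorm M₀ f₁ * schwartzNorm M₀ f₂ * schwartzNorm M₀ g)
    (hDG : ∀ N : ℕ, N ≤ N₁ → ∀ (n v : E4),
      (∃ (μ ν : Fin 4) (s s' : ℝ), μ ≠ ν ∧ (s = 1 ∨ s = -1) ∧ (s' = 1 ∨ s' = -1) ∧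
        n = (Real.sqrt 2)⁻¹ • (s • (EuclideanSpace.single μ (1 : ℝ) : E4) + s' • (EuclideanSpace.single ν (1 : ℝ) : E4)) ∧
        v = (Real.sqrt 2)⁻¹ • (s • (EuclideanSpace.single μ (1 : ℝ) : E4) - s' • (EuclideanSpace.single ν (1 : ℝ) : E4))) →
      ∀ δ : ℝ, 0 < δ → δ ≤ 1 → ∀ (c : ℝ) (f₁ f₂ g : 𝓢(E4, ℂ)),
        HasCompactSupport (f₁ : E4 → ℂ) → HasCompactSupport (f₂ : E4 → ℂ) → HasCompactSupport (g : E4 → ℂ) →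
        tsupport (f₁ : E4 → ℂ) ⊆ {x : E4 | inner ℝ x n < c} → tsupport (f₂ : E4 → ℂ) ⊆ {x : E4 | inner ℝ x n < c} →
        tsupport (g : E4 → ℂ) ⊆ {x : E4 | c + δ < inner ℝ x n} →
        Disjoint (tsupport (f₁ : E4 → ℂ)) (tsupport (f₂ : E4 → ℂ)) →
        ∀ w : E4, (w = n ∨ w = v) → ∀ F : 𝓢((Fin 3 → E4), ℂ),
          IsTensorOf F ![f₁, f₂, ((LineDeriv.lineDerivOp w : 𝓢(E4, ℂ) → 𝓢(E4, ℂ))^[N] g)] →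
            ‖S₃ F‖ ≤ Cst * (1 / δ) ^ pst * schwartzNorm M₀ f₁ * schwartzNorm M₀ f₂ * schwartzNorm M₀ g)
    {c : ℝ} {y : Fin 3 → E4} {r : ℝ} {k₁ k₂ : Fin 3} (hk : k₁ ≠ k₂)
    (h₁ : (∃ (μ : Fin 4) (s : ℝ), (s = 1 ∨ s = -1) ∧
        (∀ i, i ≠ k₁ → inner ℝ (y i) (s • (EuclideanSpace.single μ (1 : ℝ) : E4)) + c * r ≤
          inner ℝ (y k₁) (s • (EuclideanSpace.single μ (1 : ℝ) : E4))) ∧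
        (∀ i i', i ≠ k₁ → i' ≠ k₁ → i ≠ i' →
          c * r ≤ |inner ℝ (y i) (EuclideanSpace.single μ (1 : ℝ) : E4) - inner ℝ (y i') (EuclideanSpace.single μ (1 : ℝ) : E4)|)) ∨
      (∃ t : Fin 4 → E4, LinearIndependent ℝ t ∧ ∀ j, ∃ n v : E4, (∃ (μ ν : Fin 4) (s s' : ℝ), μ ≠ ν ∧ (s = 1 ∨ s = -1) ∧ (s' = 1 ∨ s' = -1) ∧
      n = (Real.sqrt 2)⁻¹ • (s • (EuclideanSpace.single μ (1 : ℝ) : E4) + s' • (EuclideanSpace.single ν (1 : ℝ) : E4)) ∧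
      v = (Real.sqrt 2)⁻¹ • (s • (EuclideanSpace.single μ (1 : ℝ) : E4) - s' • (EuclideanSpace.single ν (1 : ℝ) : E4))) ∧ (t j = n ∨ t j = v) ∧
        ∀ i, i ≠ k₁ → inner ℝ (y i) n + c * r ≤ inner ℝ (y k₁) n))
    (h₂ : (∃ (μ : Fin 4) (s : ℝ), (s = 1 ∨ s = -1) ∧
        (∀ i, i ≠ k₂ → inner ℝ (y i) (s • (EuclideanSpace.single μ (1 : ℝ) : E4)) + c * r ≤
          inner ℝ (y k₂) (s • (EuclideanSpace.single μ (1 : ℝ) : E4))) ∧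
        (∀ i i', i ≠ k₂ → i' ≠ k₂ → i ≠ i' →
          c * r ≤ |inner ℝ (y i) (EuclideanSpace.single μ (1 : ℝ) : E4) - inner ℝ (y i') (EuclideanSpace.single μ (1 : ℝ) : E4)|)) ∨
      (∃ t : Fin 4 → E4, LinearIndependent ℝ t ∧ ∀ j, ∃ n v : E4, (∃ (μ ν : Fin 4) (s s' : ℝ), μ ≠ ν ∧ (s = 1 ∨ s = -1) ∧ (s' = 1 ∨ s' = -1) ∧
      n = (Real.sqrt 2)⁻¹ • (s • (EuclideanSpace.single μ (1 : ℝ) : E4) + s' • (EuclideanSpace.single ν (1 : ℝ) : E4)) ∧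
      v = (Real.sqrt 2)⁻¹ • (s • (EuclideanSpace.single μ (1 : ℝ) : E4) - s' • (EuclideanSpace.single ν (1 : ℝ) : E4))) ∧ (t j = n ∨ t j = v) ∧
        ∀ i, i ≠ k₂ → inner ℝ (y i) n + c * r ≤ inner ℝ (y k₂) n))
    {s : ℝ} (hs : 0 < s) (hs1 : s ≤ 1) (hsr : s ≤ c * r) (hsd : ∀ i j, i ≠ j → s ≤ dist (y i) (y j)) :
    ∃ κ : (Fin 3 → E4) → ℂ, ContinuousOn κ {z | ∀ i, z i ∈ Metric.ball (y i) (s / 8 / 2)} ∧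
      (∀ z : Fin 3 → E4, (∀ i, z i ∈ Metric.ball (y i) (s / 8 / 2)) →
        ‖κ z‖ ≤ Cst * (1 / (s / 2)) ^ pst * (B₀ * (s / 8)⁻¹ ^ q * (1 + ‖y‖) ^ q)) ∧
      ∀ F : 𝓢((Fin 3 → E4), ℂ), tsupport (F : (Fin 3 → E4) → ℂ) ⊆ {z | ∀ i, z i ∈ Metric.ball (y i) (s / 8 / 2)} →
        Integrable (fun z => κ z * F z) ∧ S₃ F = ∫ z, κ z * F z := by
  classical
  obtain ⟨D₁, hm₁, hsp₁, hb₁⟩ := slotData_of_good S₃ hsymm hAX hDG hs hs1 hsr hsd h₁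
  obtain ⟨D₂, hm₂, hsp₂, hb₂⟩ := slotData_of_good S₃ hsymm hAX hDG hs hs1 hsr hsd h₂
  -- the direction assignment: `D₁` at `k₁`, `D₂` at `k₂`, nothing at the third slot
  let D : Fin 3 → Finset E4 := fun k => if k = k₁ then D₁ else if k = k₂ then D₂ else ∅
  have hD₁ : D k₁ = D₁ := by simp [D]
  have hD₂ : D k₂ = D₂ := by simp [D, hk.symm]
  have hD₃ : ∀ k, k ≠ k₁ → k ≠ k₂ → D k = ∅ := fun k h h' => by simp [D, h, h']
  -- the normalised functional
  set A : ℝ := Cst * (1 / (s / 2)) ^ pst with hA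
  have hA0 : 0 < A := by positivity
  have hAC : (A : ℂ) ≠ 0 := Complex.ofReal_ne_zero.2 hA0.ne'
  set Λ : 𝓢((Fin 3 → E4), ℂ) →L[ℂ] ℂ := ((A : ℂ)⁻¹) • S₃ with hΛdef
  have hΛ : ∀ F, Λ F = (A : ℂ)⁻¹ * S₃ F := fun F => rfl
  have hΛtr : ∀ (a : E4) (F : 𝓢((Fin 3 → E4), ℂ)), IsOffDiagonal F → Λ (translateMulti a F) = Λ F :=
    fun a F hF => by rw [hΛ, hΛ, htr a F hF]
  have hmenu : ∀ k, ∀ t ∈ D k, ∃ n v : E4, ((∃ (μ ν : Fin 4) (s s' : ℝ), μ ≠ ν ∧ (s = 1 ∨ s = -1) ∧ (s' = 1 ∨ s' = -1) ∧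
            n = s • (EuclideanSpace.single μ (1 : ℝ) : E4) ∧ v = s' • (EuclideanSpace.single ν (1 : ℝ) : E4)) ∨
          (∃ (μ ν : Fin 4) (s s' : ℝ), μ ≠ ν ∧ (s = 1 ∨ s = -1) ∧ (s' = 1 ∨ s' = -1) ∧
            n = (Real.sqrt 2)⁻¹ • (s • (EuclideanSpace.single μ (1 : ℝ) : E4) + s' • (EuclideanSpace.single ν (1 : ℝ) : E4)) ∧
            v = (Real.sqrt 2)⁻¹ • (s • (EuclideanSpace.single μ (1 : ℝ) : E4) - s' • (EuclideanSpace.single ν (1 : ℝ) : E4)))) ∧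
          (t = n ∨ t = v) := by
    intro k t ht
    by_cases hk1 : k = k₁
    · exact hm₁ t (by rwa [hk1, hD₁] at ht)
    by_cases hk2 : k = k₂
    · exact hm₂ t (by rwa [hk2, hD₂] at ht)
    exact absurd (by rwa [hD₃ k hk1 hk2] at ht) (Finset.notMem_empty t)
  have hspan := top_le_span_slots D hk (by rw [hD₁]; exact hsp₁) (by rw [hD₂]; exact hsp₂)
  have hslot : ∀ (k : Fin 3), ∀ t ∈ D k, ∀ N : ℕ, N ≤ N₁ → ∀ f : Fin 3 → 𝓢(E4, ℂ),
      (∀ i, tsupport (f i : E4 → ℂ) ⊆ Metric.ball (y i) (s / 8)) → ∀ F : 𝓢((Fin 3 → E4), ℂ),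
        IsTensorOf F (Function.update f k ((LineDeriv.lineDerivOp t : 𝓢(E4, ℂ) → 𝓢(E4, ℂ))^[N] (f k))) →
          ‖Λ F‖ ≤ ∏ i, schwartzNorm M₀ (f i) := by
    intro k t ht N hN f hf F hF
    have hb : ‖S₃ F‖ ≤ A * ∏ i, schwartzNorm M₀ (f i) := by
      by_cases hk1 : k = k₁
      · exact hb₁ t (by rwa [hk1, hD₁] at ht) N hN f hf F (by rwa [hk1] at hF)
      by_cases hk2 : k = k₂
      · exact hb₂ t (by rwa [hk2, hD₂] at ht) N hN f hf F (by rwa [hk2] at hF)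
      exact absurd (by rwa [hD₃ k hk1 hk2] at ht) (Finset.notMem_empty t)
    rw [hΛ, norm_mul, norm_inv, Complex.norm_real, Real.norm_of_nonneg hA0.le, inv_mul_le_iff₀ hA0]
    exact hb
  obtain ⟨K, hKc, hKb, hKrep⟩ := hreg D hmenu hspan y (s / 8) (by positivity) (by linarith)
    (fun i j hij => by have := hsd i j hij; linarith) Λ hΛtr hslot
  refine ⟨fun z => (A : ℂ) * K z, continuousOn_const.mul hKc, fun z hz => ?_, fun F hF => ?_⟩
  · rw [norm_mul, Complex.norm_real, Real.norm_of_nonneg hA0.le]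
    exact mul_le_mul_of_nonneg_left (hKb z hz) hA0.le
  · obtain ⟨hi, hΛF⟩ := hKrep F hF
    refine ⟨by simpa only [mul_assoc] using hi.const_mul (A : ℂ), ?_⟩
    have h1 : S₃ F = (A : ℂ) * Λ F := by rw [hΛ, ← mul_assoc, mul_inv_cancel₀ hAC, one_mul]
    rw [h1, hΛF, ← integral_const_mul]
    simp only [mul_assoc]

end ThreePointKernel

end Summit.QuantumFields.YangMills.Theorems.TemperedCurvatureMoments.Sketch

end
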